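import Mathlib.Algebra.BigOperators.Group.Finset.Basic
import Mathlib.Algebra.Order.BigOperators.Group.Finset
import Mathlib.Algebra.Polynomial.Div
import Mathlib.Algebra.Ring.Parity
import Mathlib.Algebra.Group.Int.Units
import Mathlib.Tactic.Linarith
import Mathlib.Tactic.NormNum
import Mathlib.Tactic.Ring
import Mathlib.Tactic.IntervalCases
import HarnessLib

/-!
# The (0,1) cell of the ι-window, XIII: THEOREM EB — the even (rank-0) push-forward branch is void on every ppav fourfold — algebraic skeleton

Family `hodge`, b2b cell `hweil` (helper of item stmt-HodgeConjecture-2524). Report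
`run/shared/lean/b2b/hodge-weil/b2b-hweil-pv1-g25/H2-ZERO-ONE-13.md` (prover 1 gen 25). Companion to `WeilTypeLadderH2LeadAVoid.lean` (gen 24: THEOREM LA,
LOCAL INDEX LEMMA) and `WeilTypeLadderH2EquivariantSemiregularity.lean` (gen 23: THEOREM U). HONEST FRAMING: an exclusion result inside the ladder's H2 test
((0,1) cell); no case of the Hodge conjecture is proved; nothing here is a rung; no statement of [Markman 2025] or [Perry 2026] is used as a fact, and
THEOREM U is not used either. The kernel content is the (elementary) arithmetic of the report; the geometry is the quoted print (H. Lange, *Abelian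
Varieties over the Complex Numbers*, Grundlehren Text Edition (2023), Lemma 2.3.12 / Prop. 2.3.14–2.3.15 / Cor. 2.3.16 = the count of half-periods of
odd multiplicity on a symmetric divisor; Matsumura Thm. 14.7 = associativity formula for multiplicities) and the cell's certified items (holomorphic
Lefschetz at isolated fixed points; the push-forward dictionary; the cyclic LOCAL INDEX LEMMA of report XII §2.1).

## THEOREM EB (report §1–§2), in one paragraph

Let `X` be ANY ppav fourfold, `η ∈ X̂[2] ∖ 0`, `ρ : X̃ → X` the étale double cover, `ι′ ∈ {−1, t_y ∘ (−1)}` a lift of `ι = −1_X` (256 isolated fixed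
points, `dι′ = −1`). A rank-0 (0,1) sheaf `F′` (classes in `2Γw` with `c₁ ∈ {2θ, 6θ}`) with `F′ ≅ F′ ⊗ P_η` would be `ρ_*G̃′` with `G̃′` a simple
`ι′`-equivariant TORSION sheaf on `X̃` with `c₁(G̃′) = mθ̃`, `m ∈ {1, 3}` odd, `χ(G̃′,G̃′) = 12`, `e₂^{ι′}(G̃′) ≤ 12`. LEMMA ODM (report §1): at an isolated
fixed point, an equivariant torsion module `M` over `R = ℂ[[x₁..x₄]]` (`ι′ = −1`) has local index
`t(M) ≡ 2·Σ{ℓ_𝔭(M) : 𝔭 = (h) an ι′-invariant height-one prime with ord h odd} (mod 4)` — by the equivariant cyclic filtration, the cyclic formula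
`t(R/I) = 2^{4−d} h_I(−1)` (`d = dim R/I ≤ 3`), `h(−1) ≡ h(1) = e(R/I) (mod 2)` (`ebv_eval_parity`, `ebv_cyclic_dim_three`), the associativity formula
and the orbit bookkeeping mod 4 (`ebv_mod_four_reduction`, `ebv_orbit_parity`, `ebv_two_odd_mod_four`); hence `|t_x(G̃′)| ≥ 2` at every fixed point where
the divisorial cycle `D = D(G̃′)` (class `mθ̃`, type `(m,m,m,2m)`: three odd elementary divisors, symmetric) has ODD multiplicity
(`ebv_index_sq_ge_four`). By Lange's Prop. 2.3.15 the number of such half-periods is `112`, `144` or `128` (`ebv_forced_count`), so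
`Σ_x t_x(G̃′)² ≥ 4·112 = 448` (`ebv_sum_sq_lower`); but holomorphic Lefschetz for `R𝓗om(G̃′,G̃′)` with `e₀ = e₄ = 1`, `e₃ = e₁`, `χ = 12`, `e₂^{ι′} ≤ 12`
gives `Σ t² = 16χ_{ι′} ≤ 256` (`ebv_lefschetz_cap`) — contradiction (`ebv_contradiction`). So the even branch of report XII §9 is EMPTY on every ppav
fourfold, with no purity / hull / incidence hypothesis. Downstairs COROLLARY D-EVEN: the support divisor of a rank-0 (0,1) sheaf on `X` itself is an EVEN
member of `|2Θ|` (resp. `|6Θ|`) with even multiplicity at every half-period (`ebv_downstairs_even`). Report §4 (the product ground `B₁ × B₂`): the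
unique rank-(1,1) two-term box decomposition of the H2 class (`pb_box_decomposition_unique`, `pb_box_point_class`) defines a family of extensions whose
`Ext¹` is 9-dimensional and entirely ι-invariant once the local indices are balanced (`pb_chi_WZ`, `pb_ext1_dim`, `pb_lefschetz_pair`,
`pb_ext1_character`, `pb_kunneth_ext1`, `pb_ext1_BA_invariant`, `pb_euler_total`), whence `e₁^ι ≥ 8 > 1` (`pb_e1_lower_bound`): THEOREM PB1, the family
is void.
-/

-- mandated namespace `Summit.HodgeConjecture.HodgeConjecture.…` (Problem = Summit) trips `linter.dupNamespace`; the lakefile disables it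
-- tree-wide (weak option), restated here so stand-alone elaboration is warning-free too.
set_option linter.dupNamespace false

namespace Summit.HodgeConjecture.HodgeConjecture.WeilTypeLadder

section EvenBranchVoid

open Finset

/-- **(M1) of LEMMA ODM (report §1.1): `h(1) ≡ h(−1) (mod 2)` for every integer polynomial `h`** — the numerator of the Hilbert series of the
tangent cone evaluated at `1` (the multiplicity) and at `−1` (the local index up to the factor `2^{4−d}`) have the same parity, since
`a − b ∣ h(a) − h(b)` with `a − b = 2`. [new] -/
theorem ebv_eval_parity (h : Polynomial ℤ) : (2 : ℤ) ∣ h.eval 1 - h.eval (-1) := by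
  have key := Polynomial.sub_dvd_eval_sub (1 : ℤ) (-1) h
  norm_num at key
  exact key

/-- **The `d = 3` cyclic term of LEMMA ODM (report §1.3).** For an `ι′`-stable ideal `I` with `dim R/I = 3` the cyclic LOCAL INDEX formula reads
`t(R/I) = 2^{4−3}·h(−1) = 2h(−1)`; if the multiplicity `e(R/I) = h(1)` is ODD then, `h(−1)` having the same parity, `t(R/I) ≡ 2 (mod 4)`. Stated for
the two integers `h1 = h(1)`, `hm1 = h(−1)`. [new] -/
theorem ebv_cyclic_dim_three (h1 hm1 : ℤ) (hpar : (2 : ℤ) ∣ h1 - hm1) (hodd : Odd h1) : (2 : ℤ) ^ (4 - 3) * hm1 % 4 = 2 := by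
  obtain ⟨k, hk⟩ := hpar
  obtain ⟨j, hj⟩ := hodd
  norm_num
  omega

/-- **The mod-4 reduction of LEMMA ODM (report §1.3).** After the cyclic filtration, `t(M) ≡ 2·Σ_𝔭 ℓ_𝔭 m_𝔭 (mod 4)` (lengths `ℓ_𝔭 ≥ 0` along the
height-one primes, orders `m_𝔭 ≥ 1`); replacing each order by its parity changes the sum by a multiple of `4`:
`4 ∣ 2Σ ℓ_i m_i − 2Σ ℓ_i (m_i mod 2)`. [new] -/
theorem ebv_mod_four_reduction (n : ℕ) (ℓ m : Fin n → ℤ) :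
    (4 : ℤ) ∣ (2 * ∑ i, ℓ i * m i) - 2 * ∑ i, ℓ i * (m i % 2) := by
  have hterm : ∀ i, (4 : ℤ) ∣ 2 * (ℓ i * m i) - 2 * (ℓ i * (m i % 2)) := by
    intro i
    have hdecomp : m i % 2 = m i - 2 * (m i / 2) := by omega
    refine ⟨ℓ i * (m i / 2), ?_⟩
    rw [hdecomp]
    ring
  have hsum : (2 * ∑ i, ℓ i * m i) - 2 * ∑ i, ℓ i * (m i % 2)
      = ∑ i, (2 * (ℓ i * m i) - 2 * (ℓ i * (m i % 2))) := by
    rw [Finset.mul_sum, Finset.mul_sum, ← Finset.sum_sub_distrib]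
  rw [hsum]
  exact Finset.dvd_sum fun i _ => hterm i

/-- **The orbit bookkeeping of LEMMA ODM (report §1.3).** `ι′` permutes the height-one primes; a two-element orbit `{𝔭, ι′𝔭}` carries equal
lengths and orders, so its contribution to `Σ ℓ_𝔭·(m_𝔭 mod 2)` is EVEN: the sum over all primes has the same parity as the sum `S_inv` over the
`ι′`-INVARIANT primes of odd order. Stated as: `S_total = S_inv + 2·S_pairs ⟹ S_total ≡ S_inv (mod 2)`. [new] -/
theorem ebv_orbit_parity (Stot Sinv Spairs : ℤ) (h : Stot = Sinv + 2 * Spairs) : Stot % 2 = Sinv % 2 := by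
  subst h
  omega

/-- **LEMMA ODM (b) (report §1.3): odd divisorial multiplicity forces index `≡ 2 (mod 4)`.** If the total `S = Σ{ℓ_𝔭 : 𝔭 invariant, m_𝔭 odd}` is
ODD — equivalently the divisorial cycle of the module has odd multiplicity at the fixed point — then `t ≡ 2S ≡ 2 (mod 4)`; in particular `t ≠ 0`
and `|t| ≥ 2`. [new] -/
theorem ebv_two_odd_mod_four (t S : ℤ) (ht : (4 : ℤ) ∣ t - 2 * S) (hS : Odd S) : t % 4 = 2 := by
  obtain ⟨k, hk⟩ := ht
  obtain ⟨j, hj⟩ := hS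
  omega

/-- **From `t ≡ 2 (mod 4)` to `t² ≥ 4` (report §2.3 STEP 3).** [new] -/
theorem ebv_index_sq_ge_four (t : ℤ) (ht : t % 4 = 2) : 4 ≤ t ^ 2 := by
  have hcase : t ≤ -2 ∨ 2 ≤ t := by omega
  rcases hcase with h | h
  · nlinarith [h]
  · nlinarith [h]

/-- **The count (report §2.2; Lange 2023, Prop. 2.3.15 with Lemma 2.3.12).** For a non-trivial symmetric divisor `D` on an abelian variety of
dimension `g = 4` whose line bundle has type `(m,m,m,2m)` with `m` odd — `s = 3` odd elementary divisors — the number of half-periods of ODD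
multiplicity is `2^{2g−s−1}(2^s − 1) = 112`, or `2^{2g−s−1}(2^s + 1) = 144`, or (case (b)) `2^{2g−1} = 128`; in every case at least `112`. [new] -/
theorem ebv_forced_count (N : ℕ)
    (hN : N = 2 ^ (2 * 4 - 3 - 1) * (2 ^ 3 - 1) ∨ N = 2 ^ (2 * 4 - 3 - 1) * (2 ^ 3 + 1) ∨ N = 2 ^ (2 * 4 - 1)) :
    (N = 112 ∨ N = 144 ∨ N = 128) ∧ 112 ≤ N := by
  rcases hN with h | h | h <;> subst h <;> norm_num

/-- **STEP 3 of THEOREM EB (report §2.3): the lower bound.** If among the `256` local indices at least `112` are `≡ 2 (mod 4)` (the half-periods of odd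
multiplicity of the support divisor, by LEMMA ODM), then `Σ_x t_x² ≥ 4·112 = 448`. [new] -/
theorem ebv_sum_sq_lower (t : Fin 256 → ℤ) (S : Finset (Fin 256)) (hS : 112 ≤ S.card) (hmod : ∀ i ∈ S, t i % 4 = 2) :
    448 ≤ ∑ i, t i ^ 2 := by
  have h1 : ∀ i ∈ S, (4 : ℤ) ≤ t i ^ 2 := fun i hi => ebv_index_sq_ge_four (t i) (hmod i hi)
  have hS' : (448 : ℤ) ≤ ∑ i ∈ S, t i ^ 2 := by
    calc (448 : ℤ) = 4 * 112 := by norm_num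
      _ ≤ 4 * (S.card : ℤ) := by exact_mod_cast Nat.mul_le_mul_left 4 hS
      _ = ∑ _i ∈ S, (4 : ℤ) := by simp [mul_comm]
      _ ≤ ∑ i ∈ S, t i ^ 2 := Finset.sum_le_sum h1
  have hsub : ∑ i ∈ S, t i ^ 2 ≤ ∑ i, t i ^ 2 :=
    Finset.sum_le_sum_of_subset_of_nonneg (Finset.subset_univ S) (fun i _ _ => sq_nonneg (t i))
  linarith

/-- **STEP 4 of THEOREM EB (report §2.3): the Lefschetz cap — the cell's count for the cover object.** Holomorphic Lefschetz for `R𝓗om(G̃′,G̃′)` at the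
`256` isolated fixed points: `2(e₀ − e₁ + e₂ − e₃ + e₄) = χ(G̃′,G̃′) + χ_{ι′}` with `χ_{ι′} = Σt²/16`; `e₀ = e₄ = 1` (simple; Serre), `e₃ = e₁`, `χ = 12`,
and `e₂ ≤ 12` (`Ext²(G̃′,G̃′)^{ι′} ⊂ Ext²_X(F′,F′)^ι`, 12-dimensional for a (0,1) sheaf): then `χ_{ι′} ≤ 16`, i.e. `Σ t² = 16χ_{ι′} ≤ 256`. [new] -/
theorem ebv_lefschetz_cap (e0 e1 e2 e3 e4 χ χι Ssq : ℤ) (he0 : e0 = 1) (he4 : e4 = 1) (he3 : e3 = e1) (hχ : χ = 12)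
    (hlef : 2 * (e0 - e1 + e2 - e3 + e4) = χ + χι) (he1 : 0 ≤ e1) (he2 : e2 ≤ 12) (hS : Ssq = 16 * χι) : Ssq ≤ 256 := by
  subst he0 he4 he3 hχ hS
  omega

/-- **THEOREM EB, the contradiction (report §2.3):** `448 ≤ Σt²` (STEP 3) and `Σt² ≤ 256` (STEP 4) cannot both hold. Hence no simple ι′-equivariant
torsion sheaf with `c₁ = mθ̃` (`m` odd) and `e₂^{ι′} ≤ 12` exists on the cover — the even (rank-0) push-forward branch of the (0,1) cell is VOID on every
ppav fourfold. [new] -/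
theorem ebv_contradiction (Ssq : ℤ) (hlow : 448 ≤ Ssq) (hcap : Ssq ≤ 256) : False := by
  omega

/-- **COROLLARY D-EVEN (report §3.3), the case analysis.** Downstairs (rank-0 (0,1) sheaf on `X` itself) the support divisor `D` has
`𝒪(D) = 𝒪(Θ_κ)^{⊗2}` or `^{⊗6}` exactly, a totally symmetric bundle `L₀` (type all even, `s = 0`); Lange's Cor. 2.3.16 gives `#X₂⁺(D) ∈ {256, 0}`
(`D` even / odd) for `L = L₀` and `128` for `L ≠ L₀`. The (0,1) condition `t ≡ 0` and LEMMA ODM make EVERY half-period of even multiplicity,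
`#X₂⁺(D) = 256`, which singles out the case '`L = L₀`, `D` even'. [new] -/
theorem ebv_downstairs_even (Nplus : ℕ) (isL0 Deven : Bool)
    (hcases : (isL0 = true ∧ Deven = true ∧ Nplus = 256) ∨ (isL0 = true ∧ Deven = false ∧ Nplus = 0) ∨ (isL0 = false ∧ Nplus = 128))
    (hall : Nplus = 256) : isL0 = true ∧ Deven = true := by
  rcases hcases with ⟨h1, h2, _⟩ | ⟨_, _, h3⟩ | ⟨_, h3⟩
  · exact ⟨h1, h2⟩
  · omega
  · omega

/-- **The H2 class on the product ground `B₁ × B₂` (report §4.1).** With `θ = θ₁ + θ₂`, `θ_i³ = 0`, `θ_i² = 2p_i`, `θ_i p_i = 0` (so `p_i` is the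
point class of `B_i` and `p₁p₂` the point class of the fourfold): `2 − θ² + θ³/3 = 2 − 2p₁ − 2θ₁θ₂ − 2p₂ + 2p₁θ₂ + 2θ₁p₂` (no `p₁p₂` term). Stated
as the identity `3·(2 − θ² ) + θ³ = 3·(2 − 2p₁ − 2θ₁θ₂ − 2p₂ + 2p₁θ₂ + 2θ₁p₂)` in a commutative ring. [new] -/
theorem pb_class_expansion {A : Type*} [CommRing A] (θ₁ θ₂ p₁ p₂ : A) (h1 : θ₁ * θ₁ = 2 * p₁) (h2 : θ₂ * θ₂ = 2 * p₂)
    (h1p : θ₁ * p₁ = 0) (h2p : θ₂ * p₂ = 0) :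
    3 * (2 - (θ₁ + θ₂) * (θ₁ + θ₂)) + (θ₁ + θ₂) * (θ₁ + θ₂) * (θ₁ + θ₂)
      = 3 * (2 - 2 * p₁ - 2 * (θ₁ * θ₂) - 2 * p₂ + 2 * (p₁ * θ₂) + 2 * (θ₁ * p₂)) := by
  have e1 : (θ₁ + θ₂) * (θ₁ + θ₂) = 2 * p₁ + 2 * (θ₁ * θ₂) + 2 * p₂ := by
    calc (θ₁ + θ₂) * (θ₁ + θ₂) = θ₁ * θ₁ + 2 * (θ₁ * θ₂) + θ₂ * θ₂ := by ring
      _ = 2 * p₁ + 2 * (θ₁ * θ₂) + 2 * p₂ := by rw [h1, h2]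
  have e2 : (θ₁ + θ₂) * (θ₁ + θ₂) * (θ₁ + θ₂) = 6 * (p₁ * θ₂) + 6 * (θ₁ * p₂) := by
    calc (θ₁ + θ₂) * (θ₁ + θ₂) * (θ₁ + θ₂) = (2 * p₁ + 2 * (θ₁ * θ₂) + 2 * p₂) * (θ₁ + θ₂) := by rw [e1]
      _ = 2 * (θ₁ * p₁) + 2 * (p₁ * θ₂) + 2 * (θ₁ * θ₁) * θ₂ + 2 * θ₁ * (θ₂ * θ₂) + 2 * (θ₂ * p₂) + 2 * (θ₁ * p₂) := by ring
      _ = 2 * 0 + 2 * (p₁ * θ₂) + 2 * (2 * p₁) * θ₂ + 2 * θ₁ * (2 * p₂) + 2 * 0 + 2 * (θ₁ * p₂) := by rw [h1p, h1, h2, h2p]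
      _ = 6 * (p₁ * θ₂) + 6 * (θ₁ * p₂) := by ring
  rw [e2, e1]
  ring

/-- **Uniqueness of the rank-(1,1) two-term box decomposition (report §4.2).** Writing the two rank-1·1 box terms as
`(1 + aθ₁ + sp₁) ⊠ (1 + bθ₂ + s′p₂)` and `(1 + a′θ₁ + tp₁) ⊠ (1 + b′θ₂ + t′p₂)`, the coefficients of `θ₁, θ₂, p₁, θ₁θ₂, p₂, θ₁p₂, p₁θ₂` of the H2
class force `a + a′ = 0 = b + b′`, `ab + a′b′ = −2`, `s + t = −2 = s′ + t′`, `as′ + a′t′ = 2 = sb + tb′`; the only integer solutions are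
`(a,b,s,t,s′,t′) = (1,−1,−2,0,0,−2)` and its mirror `(−1,1,0,−2,−2,0)` — i.e. the pair `{𝓘_{Z}(Θ₁) ⊠ 𝓘_{w}(−Θ₂), 𝓘_{w}(−Θ₁) ⊠ 𝓘_{Z}(Θ₂)}` with
`|Z| = 3`, `|w| = 1`. [new] -/
theorem pb_box_decomposition_unique (a b a' b' s t s' t' : ℤ) (h1 : a + a' = 0) (h2 : b + b' = 0) (h3 : a * b + a' * b' = -2)
    (h4 : s + t = -2) (h5 : s' + t' = -2) (h6 : a * s' + a' * t' = 2) (h7 : s * b + t * b' = 2) :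
    (a = 1 ∧ b = -1 ∧ s = -2 ∧ t = 0 ∧ s' = 0 ∧ t' = -2) ∨ (a = -1 ∧ b = 1 ∧ s = 0 ∧ t = -2 ∧ s' = -2 ∧ t' = 0) := by
  have ha' : a' = -a := by linarith
  have hb' : b' = -b := by linarith
  subst ha' hb'
  have hab : a * b = -1 := by linarith
  rcases Int.eq_one_or_neg_one_of_mul_eq_neg_one' hab with ⟨ha, hb⟩ | ⟨ha, hb⟩
  · subst ha hb
    left
    refine ⟨rfl, rfl, ?_, ?_, ?_, ?_⟩ <;> omega
  · subst ha hb
    right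
    refine ⟨rfl, rfl, ?_, ?_, ?_, ?_⟩ <;> omega

/-- **The `p₁p₂`-coefficient is then automatic (report §4.2):** for the solution of `pb_box_decomposition_unique`, `ss′ + tt′ = 0`, as the H2 class
requires (`ch₄ = 0`). [new] -/
theorem pb_box_point_class : (-2 : ℤ) * 0 + 0 * (-2) = 0 ∧ (0 : ℤ) * (-2) + (-2) * 0 = 0 := by
  constructor <;> norm_num

/-- **The Euler pairings on one ppas (report §4.3 (3)).** With `ch 𝓘_w(−Θ) = 1 − θ + 0·p`, `ch 𝓘_Z(Θ) = 1 + θ − 2p` (`|Z| = 3`), `θ² = 2p`, and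
`χ(E,F) = ∫ ch(E)^∨ ch(F)` (Todd class trivial): `χ(𝓘_w(−Θ), 𝓘_Z(Θ)) = 1·(−2) + 1·1·2 + 0·1 = 0`; `χ(𝓘_Z,𝓘_Z) = −3 − 3 = −6`;
`χ(𝓘_w,𝓘_w) = −1 − 1 = −2`. [new] -/
theorem pb_chi_WZ : (1 : ℤ) * (-2) + 1 * 1 * 2 + 0 * 1 = 0 ∧ (1 : ℤ) * (-3) + 0 + (-3) * 1 = -6 ∧ (1 : ℤ) * (-1) + 0 + (-1) * 1 = -2 := by
  refine ⟨by norm_num, by norm_num, by norm_num⟩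

/-- **`dim Ext¹(𝓘_w(−Θ), 𝓘_Z(Θ)) = 3` (report §4.3 (3)):** `hom = h⁰(𝓘_{Z′}(2Θ)) = 4 − 1 = 3` (the length-2 residual imposes one condition on the
Kummer system), `ext² = hom(𝓘_Z(Θ), 𝓘_w(−Θ)) = 0`, `χ = 0`. [new] -/
theorem pb_ext1_dim (hom ext1 ext2 : ℤ) (hhom : hom = 4 - 1) (hext2 : ext2 = 0) (hchi : hom - ext1 + ext2 = 0) : ext1 = 3 := by
  omega

/-- **The Lefschetz trace for the pair (report §4.3 (3)).** On the surface, `L(ι) = ¼ Σ_{x ∈ B[2]} t_x(𝓘_w(−Θ_κ))·t_x(𝓘_Z(Θ_κ))`; both index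
patterns are `λ q_κ(x)(1 − 4δ_w(x))` (balanced `Z ∋ w`), so the sum is `λμ·(15·1 + (−3)²) = 24λμ` and `L(ι) = 6λμ`. [new] -/
theorem pb_lefschetz_pair : (15 : ℤ) * (1 * 1) + (1 - 4) * (1 - 4) = 24 ∧ (24 : ℤ) = 4 * 6 := by
  constructor <;> norm_num

/-- **The character of `Ext¹` (report §4.3 (3)).** `L(ι) = tr Ext⁰ − tr Ext¹ + tr Ext²` with `tr Ext⁰ = 3σ` (three even Kummer sections, `σ = λμ`),
`Ext² = 0`, `L = 6σ`: so `tr(ι | Ext¹) = −3σ`; a `±1`-diagonalisable involution on a 3-dimensional space with trace `∓3` has all three eigenvalues equal —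
`Ext¹` is of PURE sign `−σ`. Stated for `σ = 1` with eigenvalue counts `nplus + nminus = 3`, `nplus − nminus = trace` (both determined). [new] -/
theorem pb_ext1_character (tr0 tr1 L nplus nminus : ℤ) (htr0 : tr0 = 3) (hL : L = 6) (hlef : L = tr0 - tr1 + 0)
    (hdim : nplus + nminus = 3) (htr : nplus - nminus = tr1) : nplus = 0 ∧ nminus = 3 := by
  subst htr0 hL
  omega

/-- **Künneth in degree one (report §4.3 (4)).** `Ext¹(B,A) = Hom ⊗ Ext¹ ⊕ Ext¹ ⊗ Hom` over the two factors, of dimension `3·3 + 3·0 = 9`; likewise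
`Ext¹(A,B)` has dimension `3·3 + 0·3 = 9`, and `Ext²(B,A)` has dimension `3·3 + 3·3 + 0·0 = 18`. [new] -/
theorem pb_kunneth_ext1 : (3 : ℕ) * 3 + 3 * 0 = 9 ∧ (3 : ℕ) * 3 + 0 * 3 = 9 ∧ (3 : ℕ) * 3 + 3 * 3 + 0 * 0 = 18 := by
  refine ⟨by norm_num, by norm_num, by norm_num⟩

/-- **`Ext¹(B,A)` is entirely ι-invariant once the indices are balanced (report §4.3 (4)).** Its sign is `(λ₁μ₁)·(−λ₂μ₂) = −λ_A λ_B` with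
`λ_A = λ₁μ₂`, `λ_B = μ₁λ₂` (signs multiply under `⊠` and under `𝓗om`), and t-BALANCE forces `λ_B = −λ_A`; so the sign is `+1`. [new] -/
theorem pb_ext1_BA_invariant (l1 m1 l2 m2 lA lB : ℤ) (hlA : lA = l1 * m2) (hlB : lB = m1 * l2) (hbal : lB = -lA)
    (hl1 : l1 = 1 ∨ l1 = -1) (hm2 : m2 = 1 ∨ m2 = -1) : (l1 * m1) * (-(l2 * m2)) = 1 := by
  have hsq : lA * lA = 1 := by
    subst hlA
    rcases hl1 with h | h <;> rcases hm2 with h' | h' <;> subst h h' <;> norm_num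
  have key : (l1 * m1) * (-(l2 * m2)) = -(lA * lB) := by subst hlA hlB; ring
  rw [key, hbal]
  linarith [hsq]

/-- **Cross-check `χ(F,F) = 24` (report §4.3 (4)):** `χ(A,A) + χ(B,B) + χ(A,B) + χ(B,A) = (−6)(−2) + (−2)(−6) + 0 + 0 = 24 = χ(v,v)`, and the
Euler characteristic of `Ext^•(B,A) = (0,9,18,9,0)` is `0`. [new] -/
theorem pb_euler_total : (-6 : ℤ) * (-2) + (-2) * (-6) + 0 + 0 = 24 ∧ (0 : ℤ) - 9 + 18 - 9 + 0 = 0 := by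
  constructor <;> norm_num

/-- **THEOREM PB1, conclusion (report §4.3 (5)): `e₁^ι(F) ≥ 8`.** By EXT-BOUND, `e₁^ι(F) ≥ dim Ext¹(B,A)^{χ_e} − 1`; the eigenspace containing the
class is all of `Ext¹(B,A)`, 9-dimensional, so `e₁^ι(F) ≥ 8`, incompatible with the (0,1) value `e₁^ι = 1`. [new] -/
theorem pb_e1_lower_bound (e1 d : ℤ) (hd : d = 9) (hbound : d - 1 ≤ e1) : 8 ≤ e1 ∧ e1 ≠ 1 := by
  subst hd
  constructor <;> omega

end EvenBranchVoid

section EvenBranchVoidAddendum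

/-!
### ADDENDUM 1 (report XIII §9, same seat): THEOREM EB for complexes, COROLLARY EB′, TOOL (PARAM), LEAD (Ψ8-A)

THEOREM EB holds for simple gluable ι′-equivariant perfect COMPLEXES on the cover all of whose cohomology sheaves are torsion, with
`c₁ = Σ(−1)^i c₁(H^i) = mθ̃`, `m` odd: the local index is additive on triangles, so `t_x ≡ 2·Σ_i [mult_x D(H^i) odd] ≡ 2·mult_x(Σ_i D(H^i)) (mod 4)`, and
the total divisor `Σ_i D(H^i)` has class `m′θ̃` with `m′ ≡ m (mod 2)` (`ebv_complex_parity`, `ebv_complex_index`). COROLLARY EB′: a (0,1) SHEAF `F` with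
`F ≅ t_a^*F` (`a ∈ X[2] ∖ 0`) is not generically acyclic — else `Φ(F)` (rank `χ(F ⊗ P_ξ) = 0`-type bookkeeping: all `Φ^i(F)` torsion) descends to such a
complex on `X̃_a`. TOOL (PARAM): a member of a `d`-dimensional family of pairwise non-isomorphic, translation-inequivalent ι-symmetric simple sheaves on a
FIXED fourfold has `e₁^ι ≥ d` (generic Kodaira–Spencer injectivity + upper semicontinuity), so `d ≥ 2` excludes (0,1) (`param_lower_bound`). LEAD (Ψ8-A):
on the Prym `P` of a genus-8 double cover `N → N₀` (`g(N₀) = 4`, two branch points; `Θ_J|_P ≡ 2Ξ`), the degree-5 Picard sheaf `E₅(ξ)` of `J(N)` has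
`ch = 2 + θ_J`, so `E″ := E₅(ξ)|_P(−Ξ)` has `ch = (2 + 2Ξ)e^{−Ξ} = (2, 0, −2, 4, −6)` in the divided-power basis (`psi8_picard_twist`): `c₂ = θ²`; an
elementary modification along the Abel–Prym curve `Ψ` (class `2γ`) by the canonical degree-1 quotient `𝒬 = ω_N ξ^{-1} ⊗ AP^*𝒪(−Ξ)` (`χ(ν_*𝒬) = −6`) has
EXACTLY the H2 class `v = (2,0,−2,2,0)` (`psi8_quotient_class`, `psi8_degrees`) — but the construction depends on `ξ` modulo `P`, a point of a torsor
under `J(N)/P` of dimension `g(N) − dim P = 4 ≥ 2` (`psi8_param_count`), so by TOOL (PARAM) every member has `e₁^ι ≥ 4`: dead as a (0,1) candidate.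
-/

/-- **THEOREM EB (complex form), the parity of the total divisor (report §9.1).** If the cohomology sheaves `H^i` of the complex have `c₁(H^i) = m_i θ̃`,
then `c₁` of the complex is `Σ(−1)^i m_i · θ̃` while the total support divisor `Σ_i D(H^i)` has class `Σ m_i · θ̃`; the two integers have the same
parity: `2 ∣ Σ(−1)^i m_i − Σ m_i`. [new] -/
theorem ebv_complex_parity (n : ℕ) (m : Fin n → ℤ) :
    (2 : ℤ) ∣ (∑ i : Fin n, (-1) ^ (i : ℕ) * m i) - ∑ i, m i := by
  rw [← Finset.sum_sub_distrib]
  refine Finset.dvd_sum fun i _ => ?_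
  rcases Nat.even_or_odd (i : ℕ) with h | h
  · rw [h.neg_one_pow]; exact ⟨0, by ring⟩
  · rw [h.neg_one_pow]; exact ⟨-(m i), by ring⟩

/-- **THEOREM EB (complex form), the index of the complex (report §9.1).** `t_x(G̃•) = Σ(−1)^i t_x(H^i)` (additivity on triangles) and each
`t_x(H^i) ≡ 2·o_i (mod 4)` (LEMMA ODM, `o_i` = the odd-branch length count of `H^i`); then `t_x(G̃•) ≡ 2·Σ o_i (mod 4)` (signs are invisible mod 4
after doubling). [new] -/
theorem ebv_complex_index (n : ℕ) (t o : Fin n → ℤ) (h : ∀ i, (4 : ℤ) ∣ t i - 2 * o i) :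
    (4 : ℤ) ∣ (∑ i : Fin n, (-1) ^ (i : ℕ) * t i) - 2 * ∑ i, o i := by
  rw [Finset.mul_sum, ← Finset.sum_sub_distrib]
  refine Finset.dvd_sum fun i _ => ?_
  obtain ⟨k, hk⟩ := h i
  rcases Nat.even_or_odd (i : ℕ) with he | ho
  · rw [he.neg_one_pow]; exact ⟨k, by linarith⟩
  · rw [ho.neg_one_pow]; exact ⟨-k - o i, by linarith⟩

/-- **TOOL (PARAM) (report §9.3), the arithmetic.** In a `d`-dimensional family of pairwise non-isomorphic, translation-inequivalent ι-symmetric simple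
sheaves on a fixed fourfold, the Kodaira–Spencer map is injective at a general member (`e₁^ι(general) ≥ d`) and `e₁^ι` is upper semicontinuous
(`e₁^ι(special) ≥ e₁^ι(general)`); so `d ≥ 2` forbids `e₁^ι = 1` at EVERY member. [new] -/
theorem param_lower_bound (d eGen eSpec : ℤ) (hks : d ≤ eGen) (husc : eGen ≤ eSpec) (hd : 2 ≤ d) : eSpec ≠ 1 ∧ eGen ≠ 1 := by
  constructor <;> omega

/-- **LEAD (Ψ8-A), the class of the twisted restricted Picard sheaf (report §9.4).** `ch E₅(ξ)|_P = 2 + 2Ξ` (Mukai/Mattuck: `ch = rk ± θ` for Picard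
sheaves; `Θ_J|_P ≡ 2Ξ`), and `(2 + 2Ξ)·e^{−Ξ}` has coefficients `(2, 0, −2, 4, −6)` on the divided-power basis `(1, Ξ, Ξ²/2, Ξ³/6, Ξ⁴/24)`:
degree `k` coefficient (times `k!`) of `(2 + 2Ξ)Σ(−Ξ)^j/j!` is `2·(−1)^k + 2k·(−1)^{k−1}`. [new] -/
theorem psi8_picard_twist :
    (2 : ℤ) * 1 = 2 ∧ (2 : ℤ) * (-1) + 2 * 1 = 0 ∧ (2 : ℤ) * 1 + 2 * 2 * (-1) = -2 ∧
    (2 : ℤ) * (-1) + 2 * 3 * 1 = 4 ∧ (2 : ℤ) * 1 + 2 * 4 * (-1) = -6 := by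
  refine ⟨by norm_num, by norm_num, by norm_num, by norm_num, by norm_num⟩

/-- **LEAD (Ψ8-A), the quotient class (report §9.4).** `v − ch E″ = (2,0,−2,2,0) − (2,0,−2,4,−6) = (0,0,0,−2,6) = −ch Q` with `ch Q = (0,0,0,2,−6)`:
`Q` is a rank-one sheaf on a curve of class `2γ = [Ψ]` (the Abel–Prym class) with `χ(Q) = −6`; so `F = ker(E″ ↠ Q)` has EXACTLY the H2 class, with
`c₂` of the hull `= θ²` and `ch₃(F) = 4γ − 2γ = 2γ`. [new] -/
theorem psi8_quotient_class :
    ((2 : ℤ) - 2 = 0 ∧ (0 : ℤ) - 0 = 0 ∧ (-2 : ℤ) - (-2) = 0 ∧ (2 : ℤ) - 4 = -2 ∧ (0 : ℤ) - (-6) = 6) ∧ ((4 : ℤ) - 2 = 2) := by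
  refine ⟨⟨by norm_num, by norm_num, by norm_num, by norm_num, by norm_num⟩, by norm_num⟩

/-- **LEAD (Ψ8-A), degrees on the Abel–Prym curve (report §9.4).** On the ppav4 `(P, Ξ)`, `Ξ⁴ = 24`, `[Ψ] = Ξ³/3`, so `Ξ·[Ψ] = 8` and `θ_J·[Ψ] =
2Ξ·[Ψ] = 16`; hence `deg AP^*E″ = 16 − 2·8 = 0`; the canonical quotient `𝒬 = M ⊗ AP^*𝒪(−Ξ)` (`deg M = deg ω_N − deg ξ = 14 − 5 = 9`) has degree
`9 − 8 = 1`, and `Q = ν_*𝒬` on the nodal curve (`g(N) = 8`) has `χ(Q) = 1 + 1 − 8 = −6` — the required value. For contrast, a GENERAL degree-2 quotient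
would need a section of a rank-2 bundle of degree `0 + 2·2 = 4` on genus 8, `χ = 4 + 2(1 − 8) = −10 < 0`. [new] -/
theorem psi8_degrees :
    (24 : ℤ) / 3 = 8 ∧ (2 : ℤ) * 8 = 16 ∧ (16 : ℤ) - 2 * 8 = 0 ∧ (14 : ℤ) - 5 = 9 ∧ (9 : ℤ) - 8 = 1 ∧ (1 : ℤ) + 1 - 8 = -6 ∧
    (4 : ℤ) + 2 * (1 - 8) = -10 := by
  refine ⟨by norm_num, by norm_num, by norm_num, by norm_num, by norm_num, by norm_num, by norm_num⟩

/-- **LEAD (Ψ8-A) is dead by TOOL (PARAM) (report §9.5).** The construction depends on `ξ` modulo `P`-translation, a torsor under `J(N)/P` of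
dimension `g(N) − dim P = 8 − 4 = 4 = g(N₀)`; ι-symmetry costs nothing (`σ^*ξ ⊗ ξ^{-1} ∈ P` always), so the ι-symmetric members still form a
4-parameter family on the fixed fourfold and `param_lower_bound` applies with `d = 4 ≥ 2`. [new] -/
theorem psi8_param_count (gN dimP gN0 : ℤ) (hg : gN = 8) (hP : dimP = 4) (h0 : gN0 = 4) : gN - dimP = gN0 ∧ 2 ≤ gN - dimP := by
  subst hg hP h0
  constructor <;> norm_num

end EvenBranchVoidAddendum

section OddTorsToolkit

/-!
### ADDENDUM 2 (report XIII §10, same seat): the odd-tors toolkit — class bookkeeping of the residual of row (4.3)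

For the cover object `G̃` (rank one, rigid, simple) with torsion `T ≠ 0` and `Ḡ = G̃/T = 𝓘_W ⊗ L`, `L ≡ L̃^{−d}`, write `ch T = (0, d, a, b, c)` and
`ch 𝒪_W = (0, 0, ω₂, ω₃, ω₄)` in the basis `(1, θ̃, θ̃²/2, θ̃³/6, pt̃)` of the (1,1,1,2) fourfold (`θ̃⁴ = 48 pt̃`). Comparing `w̃ − ch T` with
`ch(𝓘_W)·e^{−dθ̃}` gives `ω₂ = d² + 1 + a`, `ω₃ = 2d³ + 3d + 3da − 1 + b`, `ω₄ = 2d⁴ − 12d²ω₂ + 8dω₃ + c` (`ot_class_bookkeeping`), `deg_{θ̃} W = 24ω₂`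
(`ot_degree_W`), and with `a = −d² + s_T` the residual left by REMARK LA′ (`ω₂ ≠ 1`) is `s_T = −1` or `s_T ≥ 1` (`ot_residual_cases`). LEMMA OT of the
report (Hom(Ḡ,T) = Hom(G̃,T) = 0; `End(T)^+ ≅ Ext¹(Ḡ,T)^{χ_e}` by push-out; `(Ext¹(T,T) ⊕ Ext¹(Ḡ,Ḡ))^+ ↪ Ext²(Ḡ,T)^{χ_e}`; all sections of `T ⊗ L^{-1}`
are killed by `𝓘_W`) is homological algebra; its dimension consequences are `ot_rigidity_dims`.
-/

/-- **Class bookkeeping of the odd-tors residual (report §10.3).** With the products `θ̃·θ̃ = 2(θ̃²/2)`, `θ̃·(θ̃²/2) = 3(θ̃³/6)`, `(θ̃²/2)² = 12 pt̃`,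
`θ̃·(θ̃³/6) = 8 pt̃`, the identity `w̃ − ch T = ch(𝓘_W)·e^{−dθ̃}` in degrees 2, 3, 4 reads `−1 − a = d² − ω₂`, `1 − b = −d³ + 3dω₂ − ω₃`,
`−c = 2d⁴ − 12d²ω₂ + 8dω₃ − ω₄`; solved for the classes of `W`. [new] -/
theorem ot_class_bookkeeping (d a b c ω₂ ω₃ ω₄ : ℤ) (h2 : -1 - a = d ^ 2 - ω₂) (h3 : 1 - b = -d ^ 3 + 3 * d * ω₂ - ω₃)
    (h4 : -c = 2 * d ^ 4 - 12 * d ^ 2 * ω₂ + 8 * d * ω₃ - ω₄) :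
    ω₂ = d ^ 2 + 1 + a ∧ ω₃ = 2 * d ^ 3 + 3 * d + 3 * d * a - 1 + b ∧ ω₄ = 2 * d ^ 4 - 12 * d ^ 2 * ω₂ + 8 * d * ω₃ + c := by
  refine ⟨by linarith, ?_, by linarith⟩
  have hω₂ : ω₂ = d ^ 2 + 1 + a := by linarith
  rw [hω₂] at h3
  linarith

/-- **`deg_{θ̃} W = 24·ω₂` and REMARK LA′ (report §10.3):** the surface part of `W` has `θ̃`-degree `ω₂·(θ̃²/2 · θ̃²) = ω₂·θ̃⁴/2 = 24ω₂`; REMARK LA′ of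
report XII is the case `ω₂ = 1` (`deg W = 24`), so the residual is `ω₂ ≠ 1`, `ω₂ ≥ 0` (here `θ̃⁴/2 = 24` is substituted). [new] -/
theorem ot_degree_W (ω₂ degW : ℤ) (hdeg : degW = ω₂ * 24) : degW = 24 * ω₂ ∧ (degW = 24 ↔ ω₂ = 1) := by
  subst hdeg
  constructor <;> omega

/-- **The residual in one integer (report §10.3).** With `a = −d² + s_T` (`s_T` = the twist of `T` along its divisorial cycle plus its surface
components, in units of `θ̃²/2`): `ω₂ = 1 + s_T`; `ω₂ ≥ 0` and `ω₂ ≠ 1` (LA′) leave exactly `s_T = −1` (no surface part in `W`) or `s_T ≥ 1`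
(`deg W ≥ 48`). [new] -/
theorem ot_residual_cases (d a sT ω₂ : ℤ) (ha : a = -d ^ 2 + sT) (hω : ω₂ = d ^ 2 + 1 + a) (hnonneg : 0 ≤ ω₂) (hLA : ω₂ ≠ 1) :
    ω₂ = 1 + sT ∧ (sT = -1 ∨ 1 ≤ sT) ∧ (1 ≤ sT → 48 ≤ 24 * ω₂) := by
  subst ha
  have h1 : ω₂ = 1 + sT := by rw [hω]; ring
  refine ⟨h1, ?_, ?_⟩ <;> omega

/-- **Dimension consequences of LEMMA OT (report §10.2).** (OT1): the push-out map is injective on `End T` and onto the `χ_e`-eigenspace from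
`End(T)^+`, so `dim Ext¹(Ḡ,T)^{χ_e} = dim End(T)^+` and `dim Ext¹(Ḡ,T) ≥ dim End T`; (OT2): `dim (T_W Hilb)^+ + dim Ext¹(T,T)^+ ≤ dim Ext²(Ḡ,T)^{χ_e}`.
Stated for the integers involved. [new] -/
theorem ot_rigidity_dims (endTp endTm ext1p ext1m hilbWp ext1TTp ext2p : ℤ)
    (hinjp : endTp ≤ ext1p) (hsurjp : ext1p ≤ endTp) (hinjm : endTm ≤ ext1m) (hOT2 : hilbWp + ext1TTp ≤ ext2p)
    (h0 : 0 ≤ hilbWp) (h1 : 0 ≤ ext1TTp) :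
    ext1p = endTp ∧ endTp + endTm ≤ ext1p + ext1m ∧ hilbWp ≤ ext2p ∧ ext1TTp ≤ ext2p := by
  refine ⟨le_antisymm hsurjp hinjp, by linarith, by linarith, by linarith⟩

end OddTorsToolkit

end Summit.HodgeConjecture.HodgeConjecture.WeilTypeLadder
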